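import Literature.RingTheory.MvPowerSeries.ConvergentRename
import Mathlib.Data.Sign.Defs
import Mathlib.SetTheory.Cardinal.NatCard
import HarnessLib

/-!
# Terms of the real field with restricted analytic functions and inverse; quantifier-free sets

Topic `Literature/ModelTheory/ExponentialFields`.  The semantic term language of the structure
`(ℝ_an, ⁻¹)` of J. Denef, L. van den Dries, *p-adic and real subanalytic sets*, Ann. of Math. 128
(1988), §4 (in the variant of J.-P. Rolin, LMS Lecture Note Ser. 349 (2008), Def. 3.4 and
Thm. 3.6: restricted analytic functions and the total inverse `x ↦ x⁻¹`, `0⁻¹ = 0`):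

* `GlobalSeries m` — a real power series in `m` variables converging on a neighbourhood of the
  closed unit box (`IsGlobal`: `‖P‖_r < ∞` for some `r > 1`), with its **restricted function**
  `P.fn x = P(x)` on `[-1, 1]^m` and `0` outside;
* `Term ι` — terms in the variables `ι`: variables, real constants, `+`, `·`, `⁻¹` (Mathlib's
  `Inv.inv` on `ℝ`, so `0⁻¹ = 0`) and application of restricted global series; `Term.eval`,
  substitution `Term.subst` (`eval_subst`);
* `IsQF A` — the **quantifier-free definable sets**: `A ⊆ ℝ^ι` whose membership is decided by
  the sign vector of finitely many terms; a Boolean algebra containing the basic sets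
  `{t > 0}`, `{t = 0}`, … and stable under preimages by term maps (`IsQF.preimage`);
* germs as terms (`Term.ofGerm`, `eval_ofGerm`): a power series `f` with `‖f‖_ρ < ∞` defines, on
  every box `|v - a| ≤ δ` with `2δ < ρ`, the term `v ↦ f(v - a)` (rescale to the unit box), the
  device by which the local data of the Denef–van den Dries elimination become terms.

Everything is proved (definitions with bodies and their API); no named facts.

## References

* J. Denef, L. van den Dries, *p-adic and real subanalytic sets*, Ann. of Math. 128 (1988), §4.
  [DenefvandenDries1988]
* J.-P. Rolin, *Establishing the o-minimality for expansions of the real field*, in: Model Theory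
  with Applications to Algebra and Analysis 1, LMS LN 349, CUP (2008), §3.2. [Rolin2008]
-/

noncomputable section

open MvPowerSeries Finsupp Literature.RingTheory.MvPowerSeries
open scoped NNReal ENNReal BigOperators

namespace Literature.ModelTheory.ExponentialFields

universe u

/-! ### 1. Global series and their restricted functions -/

section Global

/-- A real power series in `m` variables is **global** if it converges on a neighbourhood of the
closed unit box: `‖P‖_r < ∞` for some constant polyradius `r > 1`. [cite: DenefvandenDries1988, §4] -/
def IsGlobal {m : ℕ} (P : MvPowerSeries (Fin m) ℝ) : Prop :=
  ∃ r : ℝ≥0, 1 < r ∧ wnorm (fun _ => r) P < ⊤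

/-- **Global series**: the function symbols of `ℝ_an` (restricted analytic functions given by one
power series converging on a neighbourhood of the unit box). [cite: DenefvandenDries1988, §4] -/
structure GlobalSeries (m : ℕ) where
  /-- the power series -/
  series : MvPowerSeries (Fin m) ℝ
  /-- it converges on a neighbourhood of the closed unit box -/
  isGlobal : IsGlobal series

/-- The closed unit box `[-1, 1]^τ`. [folklore] -/
def InBox {τ : Type*} (x : τ → ℝ) : Prop := ∀ i, ‖x i‖₊ ≤ 1

/-- Membership in the unit box via absolute values. [folklore] -/
theorem inBox_iff {τ : Type*} (x : τ → ℝ) : InBox x ↔ ∀ i, |x i| ≤ 1 := by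
  refine forall_congr' fun i => ?_
  rw [← NNReal.coe_le_coe, coe_nnnorm, Real.norm_eq_abs, NNReal.coe_one]

open Classical in
/-- **The restricted function** of a global series: `P(x)` on the unit box, `0` outside.
[cite: DenefvandenDries1988, §4] -/
def GlobalSeries.fn {m : ℕ} (P : GlobalSeries m) (x : Fin m → ℝ) : ℝ :=
  if InBox x then eval P.series x else 0

/-- On the unit box the restricted function is the sum of the series. [folklore] -/
theorem GlobalSeries.fn_of_inBox {m : ℕ} (P : GlobalSeries m) {x : Fin m → ℝ} (hx : InBox x) :
    P.fn x = eval P.series x := by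
  rw [GlobalSeries.fn, if_pos hx]

/-- Off the unit box the restricted function vanishes. [folklore] -/
theorem GlobalSeries.fn_of_not_inBox {m : ℕ} (P : GlobalSeries m) {x : Fin m → ℝ} (hx : ¬InBox x) :
    P.fn x = 0 := by
  rw [GlobalSeries.fn, if_neg hx]

/-- A global series has finite norm at the unit polyradius. [folklore] -/
theorem GlobalSeries.wnorm_one_lt_top {m : ℕ} (P : GlobalSeries m) : wnorm (fun _ => (1 : ℝ≥0)) P.series < ⊤ := by
  obtain ⟨r, hr, h⟩ := P.isGlobal
  exact wnorm_lt_top_mono (fun _ => hr.le) h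

end Global

/-! ### 2. Terms -/

section Terms

/-- **Terms of `(ℝ_an, ⁻¹)`** in the variables `ι`: variables, constants, sums, products, the total
inverse `⁻¹` (`0⁻¹ = 0`) and restricted global series applied to terms.
[cite: DenefvandenDries1988, §4] -/
inductive Term (ι : Type u) : Type u
  | var : ι → Term ι
  | const : ℝ → Term ι
  | add : Term ι → Term ι → Term ι
  | mul : Term ι → Term ι → Term ι
  | inv : Term ι → Term ι
  | app {m : ℕ} (P : GlobalSeries m) (ts : Fin m → Term ι) : Term ι

namespace Term

variable {ι ι' : Type u}

/-- **Evaluation of terms.** [cite: DenefvandenDries1988, §4] -/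
def eval : Term ι → (ι → ℝ) → ℝ
  | var i, x => x i
  | const c, _ => c
  | add s t, x => s.eval x + t.eval x
  | mul s t, x => s.eval x * t.eval x
  | inv t, x => (t.eval x)⁻¹
  | app P ts, x => P.fn fun k => (ts k).eval x

/-- Evaluation of a variable. [folklore] -/
@[simp] theorem eval_var (i : ι) (x : ι → ℝ) : (var i).eval x = x i := rfl
/-- Evaluation of a constant. [folklore] -/
@[simp] theorem eval_const (c : ℝ) (x : ι → ℝ) : (const c : Term ι).eval x = c := rfl
/-- Evaluation of a sum. [folklore] -/
@[simp] theorem eval_add (s t : Term ι) (x : ι → ℝ) : (add s t).eval x = s.eval x + t.eval x := rfl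
/-- Evaluation of a product. [folklore] -/
@[simp] theorem eval_mul (s t : Term ι) (x : ι → ℝ) : (mul s t).eval x = s.eval x * t.eval x := rfl
/-- Evaluation of an inverse. [folklore] -/
@[simp] theorem eval_inv (t : Term ι) (x : ι → ℝ) : (inv t).eval x = (t.eval x)⁻¹ := rfl
/-- Evaluation of an application. [folklore] -/
@[simp] theorem eval_app {m : ℕ} (P : GlobalSeries m) (ts : Fin m → Term ι) (x : ι → ℝ) :
    (app P ts).eval x = P.fn fun k => (ts k).eval x := rfl

/-- Negation as a term. [folklore] -/
def neg (t : Term ι) : Term ι := mul (const (-1)) t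

/-- Evaluation of a negation. [folklore] -/
@[simp] theorem eval_neg (t : Term ι) (x : ι → ℝ) : (neg t).eval x = -t.eval x := by
  simp [neg]

/-- Subtraction as a term. [folklore] -/
def sub (s t : Term ι) : Term ι := add s (neg t)

/-- Evaluation of a difference. [folklore] -/
@[simp] theorem eval_sub (s t : Term ι) (x : ι → ℝ) : (sub s t).eval x = s.eval x - t.eval x := by
  simp [sub, sub_eq_add_neg]

/-- **Substitution** of terms for the variables. [folklore] -/
def subst : Term ι → (ι → Term ι') → Term ι'
  | var i, s => s i
  | const c, _ => const c
  | add a b, s => add (a.subst s) (b.subst s)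
  | mul a b, s => mul (a.subst s) (b.subst s)
  | inv a, s => inv (a.subst s)
  | app P ts, s => app P fun k => (ts k).subst s

/-- **Evaluation of a substitution** is evaluation at the evaluated substituents. [folklore] -/
theorem eval_subst (t : Term ι) (s : ι → Term ι') (x : ι' → ℝ) :
    (t.subst s).eval x = t.eval fun i => (s i).eval x := by
  induction t with
  | var i => rfl
  | const c => rfl
  | add a b iha ihb => simp [subst, iha, ihb]
  | mul a b iha ihb => simp [subst, iha, ihb]
  | inv a ih => simp [subst, ih]
  | app P ts ih => simp [subst, ih]

end Term

end Terms

/-! ### 3. Quantifier-free definable sets -/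

section QF

variable {ι ι' : Type u}

/-- A set is **sign-decided** by a family of terms: membership only depends on the signs of the
terms. [cite: DenefvandenDries1988, §4] -/
def SignDecided {n : ℕ} (t : Fin n → Term ι) (A : Set (ι → ℝ)) : Prop :=
  ∀ x y : ι → ℝ, (∀ k, SignType.sign ((t k).eval x) = SignType.sign ((t k).eval y)) → (x ∈ A ↔ y ∈ A)

/-- **Quantifier-free definable sets of `(ℝ_an, ⁻¹)`**: sign-decided by finitely many terms.
[cite: DenefvandenDries1988, §4] -/
def IsQF (A : Set (ι → ℝ)) : Prop :=
  ∃ (n : ℕ) (t : Fin n → Term ι), SignDecided t A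

/-- Concatenating term families. [folklore] -/
theorem SignDecided.append_left {m n : ℕ} {s : Fin m → Term ι} {t : Fin n → Term ι} {A : Set (ι → ℝ)}
    (h : SignDecided s A) : SignDecided (Fin.append s t) A := by
  intro x y hxy
  refine h x y fun k => ?_
  have := hxy (Fin.castAdd n k)
  rwa [Fin.append_left] at this

/-- Concatenating term families. [folklore] -/
theorem SignDecided.append_right {m n : ℕ} {s : Fin m → Term ι} {t : Fin n → Term ι} {A : Set (ι → ℝ)}
    (h : SignDecided t A) : SignDecided (Fin.append s t) A := by
  intro x y hxy
  refine h x y fun k => ?_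
  have := hxy (Fin.natAdd m k)
  rwa [Fin.append_right] at this

/-- The empty set is quantifier-free. [folklore] -/
theorem isQF_empty : IsQF (∅ : Set (ι → ℝ)) := ⟨0, Fin.elim0, fun x y _ => by simp⟩

/-- The whole space is quantifier-free. [folklore] -/
theorem isQF_univ : IsQF (Set.univ : Set (ι → ℝ)) := ⟨0, Fin.elim0, fun x y _ => by simp⟩

namespace IsQF

/-- Complements. [folklore] -/
theorem compl {A : Set (ι → ℝ)} (hA : IsQF A) : IsQF Aᶜ := by
  obtain ⟨n, t, h⟩ := hA
  exact ⟨n, t, fun x y hxy => not_congr (h x y hxy)⟩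

/-- Unions. [folklore] -/
theorem union {A B : Set (ι → ℝ)} (hA : IsQF A) (hB : IsQF B) : IsQF (A ∪ B) := by
  obtain ⟨m, s, hs⟩ := hA
  obtain ⟨n, t, ht⟩ := hB
  exact ⟨m + n, Fin.append s t, fun x y hxy =>
    or_congr (hs.append_left x y hxy) (ht.append_right x y hxy)⟩

/-- Intersections. [folklore] -/
theorem inter {A B : Set (ι → ℝ)} (hA : IsQF A) (hB : IsQF B) : IsQF (A ∩ B) := by
  obtain ⟨m, s, hs⟩ := hA
  obtain ⟨n, t, ht⟩ := hB
  exact ⟨m + n, Fin.append s t, fun x y hxy =>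
    and_congr (hs.append_left x y hxy) (ht.append_right x y hxy)⟩

/-- Differences. [folklore] -/
theorem diff {A B : Set (ι → ℝ)} (hA : IsQF A) (hB : IsQF B) : IsQF (A \ B) := hA.inter hB.compl

/-- Finite unions. [folklore] -/
theorem biUnion {α : Type*} (S : Finset α) {A : α → Set (ι → ℝ)} (h : ∀ a ∈ S, IsQF (A a)) :
    IsQF (⋃ a ∈ S, A a) := by
  classical
  induction S using Finset.induction_on with
  | empty => simpa using isQF_empty
  | insert a S ha ih =>
    rw [Finset.set_biUnion_insert]
    exact (h a (Finset.mem_insert_self a S)).union (ih fun b hb => h b (Finset.mem_insert_of_mem hb))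

/-- Finite intersections. [folklore] -/
theorem biInter {α : Type*} (S : Finset α) {A : α → Set (ι → ℝ)} (h : ∀ a ∈ S, IsQF (A a)) :
    IsQF (⋂ a ∈ S, A a) := by
  classical
  induction S using Finset.induction_on with
  | empty => simpa using isQF_univ
  | insert a S ha ih =>
    rw [Finset.set_biInter_insert]
    exact (h a (Finset.mem_insert_self a S)).inter (ih fun b hb => h b (Finset.mem_insert_of_mem hb))

/-- Indexed finite unions. [folklore] -/
theorem iUnion {α : Type*} [Finite α] {A : α → Set (ι → ℝ)} (h : ∀ a, IsQF (A a)) :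
    IsQF (⋃ a, A a) := by
  classical
  haveI := Fintype.ofFinite α
  have : (⋃ a, A a) = ⋃ a ∈ (Finset.univ : Finset α), A a := by simp
  rw [this]; exact biUnion _ fun a _ => h a

/-- Indexed finite intersections. [folklore] -/
theorem iInter {α : Type*} [Finite α] {A : α → Set (ι → ℝ)} (h : ∀ a, IsQF (A a)) :
    IsQF (⋂ a, A a) := by
  classical
  haveI := Fintype.ofFinite α
  have : (⋂ a, A a) = ⋂ a ∈ (Finset.univ : Finset α), A a := by simp
  rw [this]; exact biInter _ fun a _ => h a

end IsQF

/-- **Basic sets**: `{x | t(x) > 0}` is quantifier-free. [cite: DenefvandenDries1988, §4] -/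
theorem isQF_setOf_pos (t : Term ι) : IsQF {x | 0 < t.eval x} := by
  refine ⟨1, fun _ => t, fun x y hxy => ?_⟩
  have h := hxy 0
  simp only [Set.mem_setOf_eq]
  rw [← sign_eq_one_iff, ← sign_eq_one_iff (a := t.eval y), h]

/-- **Basic sets**: `{x | t(x) = 0}` is quantifier-free. [cite: DenefvandenDries1988, §4] -/
theorem isQF_setOf_eq_zero (t : Term ι) : IsQF {x | t.eval x = 0} := by
  refine ⟨1, fun _ => t, fun x y hxy => ?_⟩
  have h := hxy 0
  simp only [Set.mem_setOf_eq]
  rw [← sign_eq_zero_iff, ← sign_eq_zero_iff (a := t.eval y), h]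

/-- `{x | t(x) < 0}` is quantifier-free. [folklore] -/
theorem isQF_setOf_neg (t : Term ι) : IsQF {x | t.eval x < 0} := by
  have := isQF_setOf_pos (Term.neg t)
  convert this using 1
  ext x; simp

/-- `{x | 0 ≤ t(x)}` is quantifier-free. [folklore] -/
theorem isQF_setOf_nonneg (t : Term ι) : IsQF {x | 0 ≤ t.eval x} := by
  have := (isQF_setOf_neg t).compl
  convert this using 1
  ext x; simp [not_lt]

/-- `{x | t(x) ≠ 0}` is quantifier-free. [folklore] -/
theorem isQF_setOf_ne_zero (t : Term ι) : IsQF {x | t.eval x ≠ 0} := by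
  have := (isQF_setOf_eq_zero t).compl
  simpa [Set.compl_setOf] using this

/-- `{x | s(x) < t(x)}` is quantifier-free. [folklore] -/
theorem isQF_setOf_lt (s t : Term ι) : IsQF {x | s.eval x < t.eval x} := by
  have := isQF_setOf_pos (Term.sub t s)
  convert this using 1
  ext x; simp [sub_pos]

/-- `{x | s(x) ≤ t(x)}` is quantifier-free. [folklore] -/
theorem isQF_setOf_le (s t : Term ι) : IsQF {x | s.eval x ≤ t.eval x} := by
  have := isQF_setOf_nonneg (Term.sub t s)
  convert this using 1
  ext x; simp [sub_nonneg]

/-- `{x | s(x) = t(x)}` is quantifier-free. [folklore] -/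
theorem isQF_setOf_eq (s t : Term ι) : IsQF {x | s.eval x = t.eval x} := by
  have := isQF_setOf_eq_zero (Term.sub s t)
  convert this using 1
  ext x; simp [sub_eq_zero]

/-- `{x | |s(x)| ≤ t(x)}` is quantifier-free. [folklore] -/
theorem isQF_setOf_abs_le (s t : Term ι) : IsQF {x | |s.eval x| ≤ t.eval x} := by
  have := (isQF_setOf_le s t).inter (isQF_setOf_le (Term.neg s) t)
  convert this using 1
  ext x; simp [abs_le, neg_le]
  tauto

/-- `{x | |s(x)| < t(x)}` is quantifier-free. [folklore] -/
theorem isQF_setOf_abs_lt (s t : Term ι) : IsQF {x | |s.eval x| < t.eval x} := by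
  have := (isQF_setOf_lt s t).inter (isQF_setOf_lt (Term.neg s) t)
  convert this using 1
  ext x; simp [abs_lt, neg_lt]
  tauto

/-- **Preimages under term maps**: if `A ⊆ ℝ^{ι'}` is quantifier-free and `T : ι' → Term ι`, then
`{x | (T_j(x))_j ∈ A}` is quantifier-free. [cite: DenefvandenDries1988, §4] -/
theorem IsQF.preimage {A : Set (ι' → ℝ)} (hA : IsQF A) (T : ι' → Term ι) :
    IsQF {x : ι → ℝ | (fun j => (T j).eval x) ∈ A} := by
  obtain ⟨n, t, h⟩ := hA
  refine ⟨n, fun k => (t k).subst T, fun x y hxy => ?_⟩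
  simp only [Set.mem_setOf_eq]
  refine h _ _ fun k => ?_
  have := hxy k
  rwa [Term.eval_subst, Term.eval_subst] at this

/-- The unit box in finitely many coordinates is quantifier-free. [folklore] -/
theorem isQF_inBox [Finite ι] : IsQF {x : ι → ℝ | InBox x} := by
  have := IsQF.iInter (ι := ι) (fun i : ι => isQF_setOf_abs_le (Term.var i) (Term.const 1))
  convert this using 1
  ext x
  simp only [Set.mem_setOf_eq, inBox_iff, Set.mem_iInter, Term.eval_var, Term.eval_const]

end QF

/-! ### 4. Germs of convergent power series as terms -/

section Germs

variable {ι : Type u}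

/-- Evaluation of a renamed series along an injection: `(rename ψ f)(x) = f(x ∘ ψ)`. [folklore] -/
theorem eval_rename_embedding {τ : Type*} (ψ : ι ↪ τ) (f : MvPowerSeries ι ℝ) (x : τ → ℝ) :
    eval (rename ψ f) x = eval f (x ∘ ψ) := by
  unfold eval
  have hinj : Function.Injective (mapDomain ψ : (ι →₀ ℕ) → (τ →₀ ℕ)) := mapDomain_injective ψ.injective
  rw [← hinj.tsum_eq]
  · refine tsum_congr fun d => ?_
    rw [← embDomain_eq_mapDomain, coeff_embDomain_rename, embDomain_eq_mapDomain]
    congr 1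
    unfold mono
    exact Finsupp.prod_mapDomain_index_inj ψ.injective
  · intro y hy
    by_contra hy'
    apply hy
    change coeff y (rename ψ f) * mono x y = 0
    rw [coeff_rename_eq_zero _ _ hy', zero_mul]

/-- Evaluation of a rescaled series: `(rescale a f)(x) = f(a · x)`. [folklore] -/
theorem eval_rescale (a : ι → ℝ) (f : MvPowerSeries ι ℝ) (x : ι → ℝ) :
    eval (rescale a f) x = eval f (fun i => a i * x i) := by
  unfold eval
  refine tsum_congr fun n => ?_
  rw [coeff_rescale, mul_comm _ (coeff n f), mul_assoc]
  congr 1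
  unfold mono
  rw [Finsupp.prod, Finsupp.prod, Finsupp.prod, ← Finset.prod_mul_distrib]
  exact Finset.prod_congr rfl fun i _ => by rw [mul_pow]

variable [Finite ι]

/-- A germ `f ∈ ℝ{v}` rescaled by `c` and read in the variables `Fin (card ι)`. [folklore] -/
def scaledSeries (c : ℝ≥0) (f : MvPowerSeries ι ℝ) : MvPowerSeries (Fin (Nat.card ι)) ℝ :=
  rename (Finite.equivFin ι) (rescale (fun _ => (c : ℝ)) f)

/-- Norms of the rescaled germ: `‖scaledSeries c f‖_R = ‖f‖_{cR}`. [folklore] -/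
theorem wnorm_scaledSeries (c R : ℝ≥0) (f : MvPowerSeries ι ℝ) :
    wnorm (fun _ => R) (scaledSeries c f) = wnorm (fun _ => c * R) f := by
  rw [scaledSeries]
  change wnorm (fun _ => R) (rename (Finite.equivFin ι).toEmbedding (rescale (fun _ => (c : ℝ)) f)) = _
  rw [wnorm_rename_embedding, wnorm_rescale]
  congr 1
  funext i
  simp

/-- If `‖f‖_ρ < ∞` and `0 < c < ρ` then the rescaled germ is a global series. [folklore] -/
theorem isGlobal_scaledSeries {c ρ : ℝ≥0} (hc : 0 < c) (hcρ : c < ρ) {f : MvPowerSeries ι ℝ}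
    (hf : wnorm (fun _ => ρ) f < ⊤) : IsGlobal (scaledSeries c f) := by
  refine ⟨ρ / c, (one_lt_div hc).mpr hcρ, ?_⟩
  rw [wnorm_scaledSeries, mul_div_cancel₀ _ hc.ne']
  exact hf

/-- **A germ as a term**: the term `v ↦ f(v - a)`, correct on the box `|vᵢ - aᵢ| ≤ c`.
[cite: DenefvandenDries1988, §4] -/
def Term.ofGerm (c : ℝ≥0) (f : MvPowerSeries ι ℝ) (hf : IsGlobal (scaledSeries c f)) (a : ι → ℝ) :
    Term ι :=
  Term.app ⟨scaledSeries c f, hf⟩ fun k =>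
    Term.mul (Term.const ((c : ℝ)⁻¹))
      (Term.sub (Term.var ((Finite.equivFin ι).symm k)) (Term.const (a ((Finite.equivFin ι).symm k))))

/-- **Evaluation of a germ term**: `(ofGerm c f a)(v) = f(v - a)` whenever `|vᵢ - aᵢ| ≤ c`
(`c > 0`). [cite: DenefvandenDries1988, §4] -/
theorem Term.eval_ofGerm {c : ℝ≥0} (hc : 0 < c) {f : MvPowerSeries ι ℝ} (hf : IsGlobal (scaledSeries c f))
    (a : ι → ℝ) {v : ι → ℝ} (hv : ∀ i, |v i - a i| ≤ c) :
    (Term.ofGerm c f hf a).eval v = Literature.RingTheory.MvPowerSeries.eval f (v - a) := by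
  set e := Finite.equivFin ι with he
  have hc' : (c : ℝ) ≠ 0 := by exact_mod_cast hc.ne'
  have harg : InBox (fun k : Fin (Nat.card ι) => (c : ℝ)⁻¹ * (v (e.symm k) - a (e.symm k))) := by
    rw [inBox_iff]
    intro k
    rw [abs_mul, abs_inv, abs_of_pos (by exact_mod_cast hc : (0 : ℝ) < c), inv_mul_le_iff₀
      (by exact_mod_cast hc), mul_one]
    exact hv _
  rw [Term.ofGerm, Term.eval_app]
  simp only [Term.eval_mul, Term.eval_const, Term.eval_sub, Term.eval_var]
  rw [GlobalSeries.fn_of_inBox _ harg]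
  change Literature.RingTheory.MvPowerSeries.eval (scaledSeries c f) _ = _
  rw [scaledSeries]
  change Literature.RingTheory.MvPowerSeries.eval
    (rename e.toEmbedding (rescale (fun _ => (c : ℝ)) f)) _ = _
  rw [eval_rename_embedding, eval_rescale]
  congr 1
  funext i
  simp only [Function.comp_apply, Equiv.coe_toEmbedding, Equiv.symm_apply_apply, Pi.sub_apply]
  field_simp

end Germs

end Literature.ModelTheory.ExponentialFields
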